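import Summits.QuantumFields.YangMills.Theorems.ContinuumLegGivenGap.Negative.FrozenXiFatalSubseq
import HarnessLib

/-!
# `ContinuumLegGivenGap` (stmt-QuantumFields-15828) — negative side: ULTRALOCAL clustering is fatal for every tame
# witness (the lower half of the two-sided scale pin, `ξ(β_k) ≳ a_k⁻¹`, as a theorem)

Support file for the crux item stmt-QuantumFields-15828 (shared decl `ContinuumLegGivenGap`), namespace
`…Theorems.ContinuumLegGivenGap.Negative`. Generalises `FrozenXiFatal` / `FrozenXiFatalSubseq` from a FROZEN lattice
rate `μ` to arbitrary step-dependent lattice rates `m_k` whose PHYSICAL correlation length `a_k / m_k` tends to zero —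
the barrier `FixedCouplingUltralocality` ("every ultralocal limit is trivial") and the lower half of lead c12's scaling
trichotomy, in theorem form for tamely renormalised witnesses:

* `not_isNontrivial_of_ultralocalClustering` — if, at infinitely many steps of a scheme tied to `T`
  (`IsYangMillsFor`), the connected torus correlations of the species `s` with its time-and-space translates obey
  `|corr_k(s, s ∘ τ_z; n)| ≤ C e^{-m_k n}` (`z⁰ = 0`, `n ≤ L_k`) with a `k`-uniform constant `C` and rates `m_k > 0` such
  that `m_k / a_k → ∞` (the physical correlation length `a_k/m_k` of the channel vanishes: ULTRALOCAL), and the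
  multiplicative renormalisation is tame relative to that scale (`|c_k| ≤ e^{ε m_k/a_k}` eventually, every `ε > 0`),
  then `T` is trivial in `s`;
* `eventually_not_ultralocal_of_isNontrivial` — contrapositive: for a tame non-trivial witness, every candidate
  ultralocal clustering bound fails for all large `k` — the lattice correlation length of the channel grows at least
  like `a_k⁻¹` along the witness's couplings (`ξ_k a_k ↛ 0`);
* `continuumLegGivenGap_witness_not_ultralocal` — the same read off `SmallCircleAnchor.ContinuumLegGivenGap` BY NAME.

The frozen case is `m_k ≡ μ` (`FrozenXiFatalSubseq.not_isNontrivial_of_frequently_frozenXi`). Mechanism unchanged: the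
sharp-witness truncated lattice diagonal tends to `Re T(w,w) > 0` (`tendsto_latticeTrunc_diag`) but is
`≤ c_k² (2R₀+1)⁸ M² C e^{-2 m_k t / a_k}` at every clustering step (`abs_latticeTrunc_le_of_frozen` applied at the
step's own rate). Tree only. References (context): K. Osterwalder, R. Schrader, CMP 31 (1973) §4.1; J. Glimm, A. Jaffe,
*Quantum Physics* (1987) Thm. 6.1.3; A. Jaffe, E. Witten (2000) §5–§6. No definitions, no named facts.
-/

noncomputable section

open scoped SchwartzMap
open MeasureTheory Filter Topology
open Literature.MathematicalPhysics.AQFT Literature.MathematicalPhysics.QuantumLattice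
open Literature.MathematicalPhysics.QuantumFieldTheory
open Literature.Probability.LatticeModels (Site)
open Summit.QuantumFields.YangMills.Theorems.HypercubicLimit.Negative (osTrunc twoPointNontrivial_iff_diagonal)

namespace Summit.QuantumFields.YangMills.Theorems.ContinuumLegGivenGap.Negative

variable {G : Type} [Group G] [TopologicalSpace G] [IsTopologicalGroup G] [CompactSpace G]
  [MeasurableSpace G] [BorelSpace G]

/-- **Ultralocal clustering is fatal for every tame witness.** Let OS data `T` be tied to Wilson's lattice theory
along `sch` and let `s` be a species. If at infinitely many steps the connected torus correlations of `s` with its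
translates by `n ≤ L_k` lattice units of time and any spatial offset obey `|corr_k| ≤ C e^{-m_k n}` with a `k`-uniform
constant and rates `m_k > 0` whose physical correlation length vanishes, `m_k / a_k → ∞`, and `|c_k| ≤ e^{ε m_k / a_k}`
eventually for every `ε > 0`, then `T` is trivial in `s`. [folklore] -/
theorem not_isNontrivial_of_ultralocalClustering (r : LatticeRep G) (sch : SpeciesScheme (YMSpecies G))
    (s : YMSpecies G) (T : OSData (YMSpecies G) 4) (hYM : IsYangMillsFor r sch T) {m : ℕ → ℝ} {C : ℝ}
    (hm : ∀ k, 0 < m k)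
    (hclust : ∃ᶠ k in atTop, ∀ (z : Site 4) (n : ℕ), z 0 = 0 → n ≤ sch.L k →
      |latticeConnectedCorr r.ρ (sch.β k) (2 * sch.L k + 1) s.F (s.F ∘ configShift z) n| ≤
        C * Real.exp (-(m k * n)))
    (hscale : Tendsto (fun k => m k * (sch.a k)⁻¹) atTop atTop)
    (hc : ∀ ε : ℝ, 0 < ε → ∀ᶠ k in atTop, |sch.c s k| ≤ Real.exp (ε * (m k * (sch.a k)⁻¹))) :
    ¬ T.IsNontrivial s := by
  intro hnt
  have hOS : OSReconstructionNoE1 T.schwinger := OSReconstructionNoE1.of_osAxioms T.osAxioms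
  obtain ⟨v, hv, hpos⟩ := (twoPointNontrivial_iff_diagonal hOS T.normalized s).1 hnt
  obtain ⟨w, t, R₀, Mw, ht, hR₀, hmargin, hball, hMw, hwpos⟩ := exists_sharp_witness T.schwinger s hv hpos
  have hw : tsupport (w : EuclideanSpace ℝ (Fin 4) → ℝ) ⊆ {y | 0 < y 0} :=
    fun y hy => lt_of_lt_of_le ht (hmargin hy)
  have hre := tendsto_latticeTrunc_diag r sch s T hYM hw
  set ℓ : ℝ := (osTrunc T.schwinger s w w).re with hℓ
  set D : ℕ → ℝ := fun k =>
    latticeSchwinger r.ρ sch (fun s => s.F) k (1 + 1) (fun _ => s) ![thetaTest 4 w, w] -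
      latticeSchwinger r.ρ sch (fun s => s.F) k 1 (fun _ => s) ![thetaTest 4 w] *
        latticeSchwinger r.ρ sch (fun s => s.F) k 1 (fun _ => s) ![w] with hD
  have hC0 : 0 ≤ C := by
    obtain ⟨k, hk⟩ := hclust.exists
    have h0 : (0 : ℝ) ≤ C * Real.exp (-(m k * ((0 : ℕ) : ℝ))) :=
      (abs_nonneg _).trans (hk 0 0 rfl (Nat.zero_le _))
    simpa using h0
  set K₀ : ℝ := (2 * R₀ + 1) ^ 8 * Mw ^ 2 * C with hK₀
  have hMw0 : 0 ≤ Mw := (abs_nonneg _).trans (hMw 0)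
  have hK0 : 0 ≤ K₀ := by positivity
  have hev : ∀ᶠ k in atTop, sch.a k ≤ 1 ∧ 2 * R₀ ≤ sch.a k * sch.L k :=
    ((sch.tendsto_a.eventually (gt_mem_nhds one_pos)).mono fun k hk => hk.le).and
      (sch.tendsto_L.eventually_ge_atTop (2 * R₀))
  -- along the clustering subsequence the diagonal is small, at the step's own rate …
  have hbound : ∃ᶠ k in atTop, |D k| ≤ K₀ * Real.exp (-(t * (m k * (sch.a k)⁻¹))) := by
    refine (hclust.and_eventually (hev.and (hc _ (by positivity : 0 < t / 2)))).mono ?_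
    rintro k ⟨hfk, hk, hck⟩
    have hmain := abs_latticeTrunc_le_of_frozen r sch s (hm k) hC0 ht hR₀ hmargin hball hMw k hk.1 hk.2 hfk
    have hc2 : sch.c s k ^ 2 ≤ Real.exp (t * (m k * (sch.a k)⁻¹)) := by
      have habs : |sch.c s k| ^ 2 ≤ Real.exp (t / 2 * (m k * (sch.a k)⁻¹)) ^ 2 :=
        pow_le_pow_left₀ (abs_nonneg _) hck 2
      rw [sq_abs, sq (Real.exp _), ← Real.exp_add] at habs
      convert habs using 2
      ring
    calc |D k| ≤ sch.c s k ^ 2 * K₀ * Real.exp (-(2 * m k * t * (sch.a k)⁻¹)) := hmain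
      _ ≤ Real.exp (t * (m k * (sch.a k)⁻¹)) * K₀ * Real.exp (-(2 * m k * t * (sch.a k)⁻¹)) := by gcongr
      _ = K₀ * Real.exp (-(t * (m k * (sch.a k)⁻¹))) := by
          rw [mul_comm (Real.exp _) K₀, mul_assoc, ← Real.exp_add]
          congr 2
          ring
  have hlim : Tendsto (fun k => K₀ * Real.exp (-(t * (m k * (sch.a k)⁻¹)))) atTop (𝓝 0) := by
    have h1 : Tendsto (fun k => -(t * (m k * (sch.a k)⁻¹))) atTop atBot :=
      tendsto_neg_atTop_atBot.comp (hscale.const_mul_atTop ht)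
    simpa using (Real.tendsto_exp_atBot.comp h1).const_mul K₀
  -- … while it tends to `ℓ > 0`
  have h1 : ∀ᶠ k in atTop, ℓ / 2 < D k := hre.eventually (lt_mem_nhds (half_lt_self hwpos))
  have h2 : ∀ᶠ k in atTop, K₀ * Real.exp (-(t * (m k * (sch.a k)⁻¹))) < ℓ / 2 :=
    hlim.eventually (gt_mem_nhds (half_pos hwpos))
  obtain ⟨k, hk, hk1, hk2⟩ := (hbound.and_eventually (h1.and h2)).exists
  linarith [le_abs_self (D k)]

/-- **A tame non-trivial witness is eventually NOT ultralocal**: for every candidate sequence of lattice rates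
`m_k > 0` with `m_k / a_k → ∞`, relative to which the renormalisation is tame, and every constant `C`, for all large
`k` some admissible `(z, n)` violates `|corr_k(s, s ∘ τ_z; n)| ≤ C e^{-m_k n}` — the lattice correlation length of the
`s`-channel grows at least like `a_k⁻¹` along the witness's couplings (`ξ_k a_k ↛ 0`; the lower half of the two-sided
scale pin; the upper half `ξ ≤ (Δ a_k)⁻¹` on all pairs is `HasLatticeMassGap` itself). [folklore] -/
theorem eventually_not_ultralocal_of_isNontrivial (r : LatticeRep G) (sch : SpeciesScheme (YMSpecies G))
    (s : YMSpecies G) (T : OSData (YMSpecies G) 4) (hYM : IsYangMillsFor r sch T) (hnt : T.IsNontrivial s)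
    {m : ℕ → ℝ} (hm : ∀ k, 0 < m k) (hscale : Tendsto (fun k => m k * (sch.a k)⁻¹) atTop atTop)
    (hc : ∀ ε : ℝ, 0 < ε → ∀ᶠ k in atTop, |sch.c s k| ≤ Real.exp (ε * (m k * (sch.a k)⁻¹))) (C : ℝ) :
    ∀ᶠ k in atTop, ∃ (z : Site 4) (n : ℕ), z 0 = 0 ∧ n ≤ sch.L k ∧
      C * Real.exp (-(m k * n)) <
        |latticeConnectedCorr r.ρ (sch.β k) (2 * sch.L k + 1) s.F (s.F ∘ configShift z) n| := by
  by_contra hnot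
  rw [Filter.not_eventually] at hnot
  refine not_isNontrivial_of_ultralocalClustering r sch s T hYM (C := C) hm ?_ hscale hc hnt
  refine hnot.mono fun k hk z n hz hn => ?_
  by_contra hlt
  push Not at hlt
  exact hk ⟨z, n, hz, hn, hlt⟩

/-- **The crux BY NAME: the witness's lattice correlation length is at least of order `a_k⁻¹`.** At every compact
simple `G` carrying the hypothesis of `SmallCircleAnchor.ContinuumLegGivenGap`, the witness `(r, sch, T)` the crux
returns (`β_k → ∞`, tied to the lattice, non-trivial in the curvature) admits NO ultralocal clustering of the curvature
channel relative to which it is tamely renormalised: for all rates `m_k > 0` with `m_k/a_k → ∞` and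
`|c_k| ≤ e^{ε m_k/a_k}` (every `ε`, eventually), every bound `|corr_k| ≤ C e^{-m_k n}` fails for all large `k`.
[folklore] -/
theorem continuumLegGivenGap_witness_not_ultralocal
    (h : Summit.QuantumFields.YangMills.Theses.SmallCircleAnchor.ContinuumLegGivenGap) :
    ∀ (G : Type) [Group G] [TopologicalSpace G] [IsTopologicalGroup G] [CompactSpace G],
      IsCompactSimpleLieGroup G → letI : MeasurableSpace G := borel G; haveI : BorelSpace G := ⟨rfl⟩;
      (∀ r : LatticeRep G, ∃ β₀ : ℝ, ∀ β : ℝ, β₀ ≤ β → ∃ m : ℝ, 0 < m ∧ ∃ S₁ : ℕ,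
          ∀ A B : YMSpecies G, ∃ C : ℝ, ∀ S n : ℕ, S₁ ≤ S → n ≤ S →
            |latticeConnectedCorr r.ρ β (2 * S + 1) A.F B.F n| ≤ C * Real.exp (-(m * n))) →
        ∃ (r : LatticeRep G) (sch : SpeciesScheme (YMSpecies G)) (T : OSData (YMSpecies G) 4),
          sch.HasWeakCouplingLimit ∧ IsYangMillsFor r sch T ∧ T.IsNontrivial r.curvature ∧
            ∀ (m : ℕ → ℝ), (∀ k, 0 < m k) → Tendsto (fun k => m k * (sch.a k)⁻¹) atTop atTop →
              (∀ ε : ℝ, 0 < ε → ∀ᶠ k in atTop, |sch.c r.curvature k| ≤ Real.exp (ε * (m k * (sch.a k)⁻¹))) →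
                ∀ C : ℝ, ∀ᶠ k in atTop, ∃ (z : Site 4) (n : ℕ), z 0 = 0 ∧ n ≤ sch.L k ∧
                  C * Real.exp (-(m k * n)) <
                    |latticeConnectedCorr r.ρ (sch.β k) (2 * sch.L k + 1) r.curvature.F
                        (r.curvature.F ∘ configShift z) n| := by
  intro G _ _ _ _ hG
  letI : MeasurableSpace G := borel G
  haveI : BorelSpace G := ⟨rfl⟩
  intro hgap
  obtain ⟨r, sch, T, hw, hYM, hnt, -, -⟩ := h G hG hgap
  exact ⟨r, sch, T, hw, hYM, hnt, fun m hm hscale hc C =>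
    eventually_not_ultralocal_of_isNontrivial r sch r.curvature T hYM hnt hm hscale hc C⟩

end Summit.QuantumFields.YangMills.Theorems.ContinuumLegGivenGap.Negative

end
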